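import Summits.CriticalPhenomena.PercolationContinuityZ3.Theorems.PercNearOneGluingNoHeavyLowerTailNineTypeFlip

/-!
# Nine-type programme for `Q44b`: interval certificates and the RECTANGLE LEMMA

Support file for crux `stmt-CriticalPhenomena-4575` (master-family programme, quadratic four-point row `Q44b`,
GF(2)-rank line of `prim-bnk-1` gen 16–18 / `prim-l12-p6` gen 9–10), seat `prim-bnk-1` gen 18; memo
`run/shared/lean/prim/prim-l12/FROM-prim-bnk-1-gen18-KLEITMAN-SPLIT.md` §2 and §8.

Setting as in `…NineTypeAnchor` / `…NineTypeFlip`: finite ground type `α`, up-set `𝔊` of goods, typed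
configuration `𝒯` (types `1..9`, tables `hlOK`, `contPairs`).  The residual statement of the programme (K1/K3,
memo §2): for a free point `t` that tops an H-circuit, the L-row `[tᶜ ⊆ g]` is not a GF(2)-combination of
H-rows, i.e. no `S ⊆ 𝒯` has `#{s ∈ S : s ⊆ g} ≡ [tᶜ ⊆ g]` for all goods `g`.

* `NineType.interval_certificate` — the cube certificate behind `prim-l12-p6` gen 10's INT″ observation: if
  `B ∈ 𝔊`, `B ⊆ g`, the 'free directions' `g \ B` lie inside `tᶜ ⊆ g`, and NO point `q ∈ S` satisfies
  `g \ B ⊆ q ⊆ g`, then the parity relation above is impossible (sum it over the interval `[B, g] ⊆ 𝔊`; the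
  count `#[B ∪ s, g] = 2^{|g \ (B ∪ s)|}` is odd only when `g ⊆ B ∪ s`).
* **`NineType.rectangle_no_inner_point`, `NineType.rectangle_L_row_not_H_combination` (rectangle lemma)**: the
  second-smallest H-circuits are the rectangles `{f, f+i, a, a+i}` (`f` free of type `5/7`, `a` of type `8/9`,
  `i ∉ f ∪ a`); their relation says that `f` and `a` are twins among the goods AVOIDING `i`.  Then no point avoiding
  `i` contains `(f ∪ a ∪ {i})ᶜ` (COV + tables), so the interval `[f ∪ a, univ \ {i}]` certifies that the L-row of
  the top `t = f + i` is not a combination of H-rows.  (INT m=5 census: twins 16 %, such rectangles 32 % of all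
  H-circuits; memo §8.)

Pure finite combinatorics; theorems only (no new definitions), no named facts, no sorries, standard axioms.
-/

namespace Summit.CriticalPhenomena.PercolationContinuityZ3.Theorems

namespace NineType

open Finset

/-- Table fact: every type `q ≤ 7` is HL-compatible with the free types `5, 7`. -/
theorem table_hl_low_free : ∀ q : ℕ, 1 ≤ q → q ≤ 7 → ∀ t : ℕ, (t = 5 ∨ t = 7) → hlOK q t = true := by
  intro q hq1 hq7 t ht
  interval_cases q <;> rcases ht with rfl | rfl <;> decide

variable {α : Type*} [DecidableEq α] [Fintype α]

omit [Fintype α] in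
/-- Parity of an interval of the subset lattice: for `B ⊆ g`, `#{h : B ⊆ h ⊆ g} = 2^{#(g \ B)}` is odd iff
`B = g`. [folklore] -/
theorem card_Icc_parity (B g : Finset α) (hBg : B ⊆ g) :
    ((#(Finset.Icc B g) : ℕ) : ZMod 2) = if B = g then 1 else 0 := by
  rw [Finset.card_Icc_finset hBg]
  by_cases h : B = g
  · subst h
    simp
  · have hlt : 0 < #g - #B := by
      have : #B < #g := Finset.card_lt_card (lt_of_le_of_ne hBg h)
      omega
    rw [if_neg h]
    obtain ⟨k, hk⟩ : ∃ k, #g - #B = k + 1 := ⟨#g - #B - 1, by omega⟩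
    rw [hk, pow_succ]
    push_cast
    rw [show (2 : ZMod 2) = 0 from rfl, mul_zero]

/-- **Interval certificate.**  Let `𝔊` be an up-set, `B ∈ 𝔊`, `B ⊆ g`, with `g \ B ⊆ tᶜ ⊆ g`, and let `S` be a
family no member `q` of which satisfies `g \ B ⊆ q ⊆ g`.  Then `#{s ∈ S : s ⊆ h} ≡ [tᶜ ⊆ h]` cannot hold for all
goods `h`: summed over the interval `[B, g] ⊆ 𝔊` the left side vanishes and the right side is `1`. [this work] -/
theorem interval_certificate (𝔊 : Finset (Finset α))
    (hG : ∀ g ∈ 𝔊, ∀ g' : Finset α, g ⊆ g' → g' ∈ 𝔊)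
    (B g : Finset α) (hB : B ∈ 𝔊) (hBg : B ⊆ g) (t : Finset α)
    (hJt : g \ B ⊆ tᶜ) (htg : tᶜ ⊆ g)
    (S : Finset (Finset α)) (hS : ∀ q ∈ S, ¬ (g \ B ⊆ q ∧ q ⊆ g)) :
    ¬ (∀ h ∈ 𝔊, ((#(S.filter (fun s => s ⊆ h)) : ℕ) : ZMod 2) = if tᶜ ⊆ h then 1 else 0) := by
  intro hrel
  have hIcc : ∀ h ∈ Finset.Icc B g, h ∈ 𝔊 := fun h hh => hG B hB h (Finset.mem_Icc.1 hh).1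
  -- the interval count `Σ_{h ∈ [B,g]} [u ⊆ h] = #[B ∪ u, g] ≡ [u ⊆ g ∧ g \ B ⊆ u]`
  have hcount : ∀ u : Finset α,
      (∑ h ∈ Finset.Icc B g, (if u ⊆ h then (1 : ZMod 2) else 0))
        = if (g \ B ⊆ u ∧ u ⊆ g) then 1 else 0 := by
    intro u
    rw [← Finset.sum_filter]
    by_cases hug : u ⊆ g
    · have hfilt : (Finset.Icc B g).filter (fun h => u ⊆ h) = Finset.Icc (B ∪ u) g := by
        ext h
        simp only [Finset.mem_filter, Finset.mem_Icc, Finset.union_subset_iff]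
        tauto
      rw [hfilt, Finset.sum_const, nsmul_eq_mul, mul_one]
      rw [card_Icc_parity (B ∪ u) g (Finset.union_subset hBg hug)]
      by_cases hJ : g \ B ⊆ u
      · have heq : B ∪ u = g := by
          refine Finset.Subset.antisymm (Finset.union_subset hBg hug) ?_
          intro x hx
          by_cases hxB : x ∈ B
          · exact Finset.mem_union.2 (Or.inl hxB)
          · exact Finset.mem_union.2 (Or.inr (hJ (Finset.mem_sdiff.2 ⟨hx, hxB⟩)))
        rw [if_pos heq, if_pos ⟨hJ, hug⟩]
      · have hne : B ∪ u ≠ g := by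
          intro heq
          apply hJ
          intro x hx
          rcases Finset.mem_sdiff.1 hx with ⟨hxg, hxB⟩
          rcases Finset.mem_union.1 (heq.symm ▸ hxg : x ∈ B ∪ u) with h | h
          · exact absurd h hxB
          · exact h
        rw [if_neg hne, if_neg (fun h => hJ h.1)]
    · have hfilt : (Finset.Icc B g).filter (fun h => u ⊆ h) = ∅ := by
        refine Finset.filter_eq_empty_iff.2 ?_
        intro h hh huh
        exact hug (huh.trans (Finset.mem_Icc.1 hh).2)
      rw [hfilt, Finset.sum_empty, if_neg (fun h => hug h.2)]
  -- D := Σ_{h ∈ [B,g]} #{s ∈ S : s ⊆ h}, first via the relation: = [g \ B ⊆ tᶜ ⊆ g] = 1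
  have h1 : ∑ h ∈ Finset.Icc B g, ((#(S.filter (fun s => s ⊆ h)) : ℕ) : ZMod 2) = 1 := by
    calc ∑ h ∈ Finset.Icc B g, ((#(S.filter (fun s => s ⊆ h)) : ℕ) : ZMod 2)
        = ∑ h ∈ Finset.Icc B g, (if tᶜ ⊆ h then (1 : ZMod 2) else 0) :=
          Finset.sum_congr rfl fun h hh => hrel h (hIcc h hh)
      _ = 1 := by rw [hcount tᶜ, if_pos ⟨hJt, htg⟩]
  -- second via swapping the sums: every member of `S` contributes `0`
  have h2 : ∑ h ∈ Finset.Icc B g, ((#(S.filter (fun s => s ⊆ h)) : ℕ) : ZMod 2) = 0 := by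
    calc ∑ h ∈ Finset.Icc B g, ((#(S.filter (fun s => s ⊆ h)) : ℕ) : ZMod 2)
        = ∑ h ∈ Finset.Icc B g, ∑ s ∈ S, (if s ⊆ h then (1 : ZMod 2) else 0) :=
          Finset.sum_congr rfl fun h _ => card_filter_cast S (fun s => s ⊆ h)
      _ = ∑ s ∈ S, ∑ h ∈ Finset.Icc B g, (if s ⊆ h then (1 : ZMod 2) else 0) := Finset.sum_comm
      _ = 0 := Finset.sum_eq_zero fun s hs => by rw [hcount s, if_neg (hS s hs)]
  rw [h2] at h1
  exact zero_ne_one h1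

omit [Fintype α] in
/-- Twins among the goods avoiding `i` have `f \ a` in every such good. [this work] -/
theorem rectangle_core (𝔊 : Finset (Finset α))
    (hG : ∀ g ∈ 𝔊, ∀ g' : Finset α, g ⊆ g' → g' ∈ 𝔊)
    (f a : Finset α) (i : α) (hia : i ∉ a)
    (htwin : ∀ g ∈ 𝔊, i ∉ g → (f ⊆ g ↔ a ⊆ g)) :
    ∀ g ∈ 𝔊, i ∉ g → f \ a ⊆ g := by
  intro g hg hig
  have hga : g ∪ a ∈ 𝔊 := hG g hg _ subset_union_left
  have higa : i ∉ g ∪ a := fun h => by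
    rcases Finset.mem_union.1 h with h | h
    · exact hig h
    · exact hia h
  have hf : f ⊆ g ∪ a := (htwin _ hga higa).2 subset_union_right
  intro x hx
  rcases Finset.mem_sdiff.1 hx with ⟨hxf, hxa⟩
  rcases Finset.mem_union.1 (hf hxf) with h | h
  · exact h
  · exact absurd h hxa

/-- **No point avoiding `i` contains the complement of a rectangle.**  Let `{f, f+i, a, a+i} ⊆ 𝒯` be a rectangle
(`f` free of type `5/7`, `t = insert i f` free, `a` of type `8/9`, `a' = insert i a ∈ 𝒯`, `i ∉ f ∪ a`) whose H-rows
form a circuit, i.e. `f ⊆ g ↔ a ⊆ g` for every good `g` avoiding `i`.  In a COV configuration with HL-forced goods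
and the HH-forced goods `q ∪ f'` (`q` of type `8/9`, `f'` of type `5/7`): no point `q ∌ i` contains
`(f ∪ a ∪ {i})ᶜ`.  Proof: a type-`8/9` point `q` gives the good `q ∪ f ∌ i`, whence `a ⊆ q ∪ f` and `tᶜ ⊆ q`, so
`q ∪ t = univ` (COV); a type-`≤ 7` point gives the good `q ∪ tᶜ ∌ i ⊇ f \ a` (`rectangle_core`), whence
`(insert i a)ᶜ ⊆ q` and `q ∪ a' = univ` (COV). [this work, memo §8] -/
theorem rectangle_no_inner_point (𝒯 : Finset (Finset α)) (θ : Finset α → ℕ)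
    (hθ : ∀ s ∈ 𝒯, 1 ≤ θ s ∧ θ s ≤ 9)
    (hcov : ∀ s ∈ 𝒯, ∀ s' ∈ 𝒯, s ≠ s' → s ∪ s' ≠ univ)
    (𝔊 : Finset (Finset α)) (hG : ∀ g ∈ 𝔊, ∀ g' : Finset α, g ⊆ g' → g' ∈ 𝔊)
    (hHL : ∀ s ∈ 𝒯, ∀ s' ∈ 𝒯, hlOK (θ s) (θ s') = true → s ∪ s'ᶜ ∈ 𝔊)
    (hHH : ∀ q ∈ 𝒯, ∀ f' ∈ 𝒯, (θ q = 8 ∨ θ q = 9) → (θ f' = 5 ∨ θ f' = 7) → q ∪ f' ∈ 𝔊)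
    (f : Finset α) (hf : f ∈ 𝒯) (hf57 : θ f = 5 ∨ θ f = 7) (i : α) (hif : i ∉ f)
    (t : Finset α) (ht : t ∈ 𝒯) (htf : t = insert i f) (ht57 : θ t = 5 ∨ θ t = 7)
    (a : Finset α) (hia : i ∉ a)
    (a' : Finset α) (ha' : a' ∈ 𝒯) (ha'a : a' = insert i a)
    (htwin : ∀ g ∈ 𝔊, i ∉ g → (f ⊆ g ↔ a ⊆ g)) :
    ∀ q ∈ 𝒯, i ∉ q → ¬ (f ∪ a ∪ {i})ᶜ ⊆ q := by
  intro q hq hiq hK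
  have hqt : q ≠ t := fun h => hiq (by rw [h, htf]; exact Finset.mem_insert_self i f)
  have hqa' : q ≠ a' := fun h => hiq (by rw [h, ha'a]; exact Finset.mem_insert_self i a)
  -- elements outside `f ∪ a ∪ {i}` are in `q`
  have hout : ∀ x, x ∉ f → x ∉ a → x ≠ i → x ∈ q := by
    intro x hxf hxa hxi
    apply hK
    rw [Finset.mem_compl, Finset.mem_union, Finset.mem_union, Finset.mem_singleton]
    rintro ((h | h) | h)
    · exact hxf h
    · exact hxa h
    · exact hxi h
  by_cases hq89 : θ q = 8 ∨ θ q = 9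
  · -- `q ∪ f` is a good avoiding `i`, so it contains `a`; then `tᶜ ⊆ q`
    have hgood : q ∪ f ∈ 𝔊 := hHH q hq f hf hq89 hf57
    have higood : i ∉ q ∪ f := fun h => by
      rcases Finset.mem_union.1 h with h | h
      · exact hiq h
      · exact hif h
    have haq : a ⊆ q ∪ f := (htwin _ hgood higood).1 subset_union_right
    apply hcov q hq t ht hqt
    refine Finset.eq_univ_iff_forall.2 fun x => ?_
    by_cases hxt : x ∈ t
    · exact Finset.mem_union.2 (Or.inr hxt)
    · have hxi : x ≠ i := fun h => hxt (by rw [htf, h]; exact Finset.mem_insert_self i f)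
      have hxf : x ∉ f := fun h => hxt (by rw [htf]; exact Finset.mem_insert_of_mem h)
      refine Finset.mem_union.2 (Or.inl ?_)
      by_cases hxa : x ∈ a
      · rcases Finset.mem_union.1 (haq hxa) with h | h
        · exact h
        · exact absurd h hxf
      · exact hout x hxf hxa hxi
  · -- `q` has type `≤ 7`: the good `q ∪ tᶜ` avoids `i` and contains `f \ a`
    have hq7 : θ q ≤ 7 := by
      rcases hθ q hq with ⟨_, h9⟩
      omega
    have hl : hlOK (θ q) (θ t) = true := table_hl_low_free (θ q) (hθ q hq).1 hq7 (θ t) ht57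
    have hgood : q ∪ tᶜ ∈ 𝔊 := hHL q hq t ht hl
    have higood : i ∉ q ∪ tᶜ := fun h => by
      rcases Finset.mem_union.1 h with h | h
      · exact hiq h
      · exact (Finset.mem_compl.1 h) (by rw [htf]; exact Finset.mem_insert_self i f)
    have hcore : f \ a ⊆ q ∪ tᶜ := rectangle_core 𝔊 hG f a i hia htwin _ hgood higood
    have hfa : ∀ x, x ∈ f → x ∉ a → x ∈ q := by
      intro x hxf hxa
      rcases Finset.mem_union.1 (hcore (Finset.mem_sdiff.2 ⟨hxf, hxa⟩)) with h | h
      · exact h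
      · exact absurd (by rw [htf]; exact Finset.mem_insert_of_mem hxf) (Finset.mem_compl.1 h)
    apply hcov q hq a' ha' hqa'
    refine Finset.eq_univ_iff_forall.2 fun x => ?_
    by_cases hxa' : x ∈ a'
    · exact Finset.mem_union.2 (Or.inr hxa')
    · have hxi : x ≠ i := fun h => hxa' (by rw [ha'a, h]; exact Finset.mem_insert_self i a)
      have hxa : x ∉ a := fun h => hxa' (by rw [ha'a]; exact Finset.mem_insert_of_mem h)
      refine Finset.mem_union.2 (Or.inl ?_)
      by_cases hxf : x ∈ f
      · exact hfa x hxf hxa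
      · exact hout x hxf hxa hxi

/-- **Rectangle lemma** (the second circuit class of conjecture K1, memo §8): under the hypotheses of
`rectangle_no_inner_point`, with moreover `a ∈ 𝒯` of type `8/9` (so that `f ∪ a` is an HH-good), the L-row of
the top `t = insert i f` is not a GF(2)-combination of H-rows: no family `S ⊆ 𝒯` satisfies
`#{s ∈ S : s ⊆ h} ≡ [tᶜ ⊆ h]` for every good `h`.  (Interval certificate `[f ∪ a, {i}ᶜ]`.) [this work] -/
theorem rectangle_L_row_not_H_combination (𝒯 : Finset (Finset α)) (θ : Finset α → ℕ)
    (hθ : ∀ s ∈ 𝒯, 1 ≤ θ s ∧ θ s ≤ 9)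
    (hcov : ∀ s ∈ 𝒯, ∀ s' ∈ 𝒯, s ≠ s' → s ∪ s' ≠ univ)
    (𝔊 : Finset (Finset α)) (hG : ∀ g ∈ 𝔊, ∀ g' : Finset α, g ⊆ g' → g' ∈ 𝔊)
    (hHL : ∀ s ∈ 𝒯, ∀ s' ∈ 𝒯, hlOK (θ s) (θ s') = true → s ∪ s'ᶜ ∈ 𝔊)
    (hHH : ∀ q ∈ 𝒯, ∀ f' ∈ 𝒯, (θ q = 8 ∨ θ q = 9) → (θ f' = 5 ∨ θ f' = 7) → q ∪ f' ∈ 𝔊)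
    (f : Finset α) (hf : f ∈ 𝒯) (hf57 : θ f = 5 ∨ θ f = 7) (i : α) (hif : i ∉ f)
    (t : Finset α) (ht : t ∈ 𝒯) (htf : t = insert i f) (ht57 : θ t = 5 ∨ θ t = 7)
    (a : Finset α) (ha : a ∈ 𝒯) (hia : i ∉ a) (ha89 : θ a = 8 ∨ θ a = 9)
    (a' : Finset α) (ha' : a' ∈ 𝒯) (ha'a : a' = insert i a)
    (htwin : ∀ g ∈ 𝔊, i ∉ g → (f ⊆ g ↔ a ⊆ g))
    (S : Finset (Finset α)) (hS : S ⊆ 𝒯) :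
    ¬ (∀ h ∈ 𝔊, ((#(S.filter (fun s => s ⊆ h)) : ℕ) : ZMod 2) = if tᶜ ⊆ h then 1 else 0) := by
  have hB : f ∪ a ∈ 𝔊 := by rw [Finset.union_comm]; exact hHH a ha f hf ha89 hf57
  have hBg : f ∪ a ⊆ ({i} : Finset α)ᶜ := by
    intro x hx
    rw [Finset.mem_compl, Finset.mem_singleton]
    rintro rfl
    rcases Finset.mem_union.1 hx with h | h
    · exact hif h
    · exact hia h
  have hJt : ({i} : Finset α)ᶜ \ (f ∪ a) ⊆ tᶜ := by
    intro x hx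
    rcases Finset.mem_sdiff.1 hx with ⟨hxi, hxfa⟩
    rw [Finset.mem_compl, Finset.mem_singleton] at hxi
    rw [Finset.mem_compl, htf, Finset.mem_insert, not_or]
    exact ⟨hxi, fun h => hxfa (Finset.mem_union.2 (Or.inl h))⟩
  have htg : tᶜ ⊆ ({i} : Finset α)ᶜ := by
    intro x hx
    rw [Finset.mem_compl, Finset.mem_singleton]
    intro hxi
    rw [hxi] at hx
    exact (Finset.mem_compl.1 hx) (by rw [htf]; exact Finset.mem_insert_self _ _)
  refine interval_certificate 𝔊 hG (f ∪ a) ({i} : Finset α)ᶜ hB hBg t hJt htg S ?_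
  rintro q hqS ⟨hJq, hqg⟩
  have hiq : i ∉ q := fun h => by
    have := hqg h
    rw [Finset.mem_compl, Finset.mem_singleton] at this
    exact this rfl
  refine rectangle_no_inner_point 𝒯 θ hθ hcov 𝔊 hG hHL hHH f hf hf57 i hif t ht htf ht57 a hia a' ha' ha'a
    htwin q (hS hqS) hiq ?_
  intro x hx
  apply hJq
  rw [Finset.mem_compl, Finset.mem_union, Finset.mem_union, Finset.mem_singleton, not_or, not_or] at hx
  refine Finset.mem_sdiff.2 ⟨?_, ?_⟩
  · rw [Finset.mem_compl, Finset.mem_singleton]; exact hx.2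
  · intro h
    rcases Finset.mem_union.1 h with h | h
    · exact hx.1.1 h
    · exact hx.1.2 h

end NineType

end Summit.CriticalPhenomena.PercolationContinuityZ3.Theorems
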